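import Summits.BirchSwinnertonDyer.Rank1Residual.X11b.BDPRouteHalvesClass
import HarnessLib

/-!
# Class X11b, route "BDP + converse-theorem engine + Kolyvagin": the exact size of Kolyvagin's Tamagawa defect (cell `b2b-bsdres`, sub-cell `multr1-p2`, gen 3)

HONEST FRAMING (cell `b2b-bsdres`, run/shared/lean/b2b/bsd-rank1-residual/, verbatim in every
file): the goal of the cell is to DELETE the COMBINATION-SHAPED residual classes of the
Birch–Swinnerton-Dyer formula for ALL analytic-rank `≤ 1` elliptic curves over `ℚ` — "full BSD
formula for every rank `≤ 1` curve in class `C`" assembled STRICTLY from published theorems — so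
that the rank-`≤ 1` remainder becomes exactly the CONSTRUCTION-SHAPED classes, which are TYPED
(missing-input `Prop`s), NOT attempted. This is not "finishing BSD". Sub-cell `multr1-p2` is a
RESEARCH ROUTE on class X11b (`ClassX11b W p := r_an = 1 ∧ p ≠ 2 ∧ mult(p) ∧ irr(p)`,
`Partition/Rows.lean`); no claim beyond the stated class and locus; X11b's label does not change;
nothing is booked by this file.

THEOREMS ONLY (no definition, no named fact). `X11b/BDPRouteHalvesClass.lean` proves the
Euler-system half `ord_p #Ш(E) ≤ ord_p #Ш(E)_an` UNCONDITIONALLY on the route's `Locus`, where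
`p ∤ ∏_ℓ c_ℓ(E)`. Off `Locus` — on the cell's atom "X11b ∧ (ram) ∧ `p ∣ ∏c_ℓ`" — the same published
inputs still give an UNCONDITIONAL inequality, with Kolyvagin's Tamagawa defect made EXACT:

* `padicValNat_shaOrder_le_add_of_shaIndexBound` (pointwise, at Heegner data) and
  `padicValNat_shaOrder_le_add_of_classX11b_of_ram` (class level, from the same TEN published named
  facts as `missingUpperBoundAt_of_classX11b_of_locus`): for every `(E,p)` in X11b with `p ≥ 5` and
  a (ram) prime, `#Ш(E)_an` is a rational `q` and
  `ord_p #Ш(E) ≤ ord_p q + 2·ord_p ∏_ℓ c_ℓ(E)`.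
  (Kolyvagin's bound `ord_p #Ш(E/K) ≤ 2·ord_p [E(K):ℤP]` is blind to the Tamagawa term
  `ord_p ∏_w c_w(E/K) = 2·ord_p ∏_ℓ c_ℓ(E)` of BSD over a field `K` in which every `ℓ ∣ N` splits;
  Jetchev, Compos. Math. 144 (2008) Cor. 1.5 recovers `2·max_q ord_p c_q` of it under `p ∤ N`, and
  Jetchev–Skinner–Wan 2017 §7.4.2 all of it at good `p` through the Shimura-curve parametrisation
  `X_{N⁺,N⁻}` — neither printed at `p ∥ N` with the classical parametrisation.)

Together with `missingLowerBoundAt_of_classX11b_of_ram` (STEP L ⇒ `ord_p #Ш(E)_an ≤ ord_p #Ш(E)`)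
this sandwiches `ord_p #Ш(E)` on X11b ∧ `p ≥ 5` ∧ (ram):
`ord_p #Ш_an ≤ ord_p #Ш ≤ ord_p #Ш_an + 2·ord_p ∏c_ℓ`, the left inequality CONDITIONAL on STEP L,
the right one a theorem of the published record.

References: [JetchevSkinnerWan2017] §7.4.2 (p. 31), Thm. 4.4.1; [Jetchev2008] Cor. 1.5 (p. 3);
[McCallumLMS1991] §1; [Skinner2016PacificMC] Thm. C; [Miller2011LMS] Def. 1.1.
-/

noncomputable section

open scoped Classical

open WeierstrassCurve NumberField Literature.NumberTheory.EllipticCurves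
  Literature.NumberTheory.EllipticCurves.ModularForms
  Literature.NumberTheory.EllipticCurves.Rank1Residual
  Literature.NumberTheory.EllipticCurves.KrizLi2019

namespace Summit.BirchSwinnertonDyer.Rank1Residual.X11b

/-- **Kolyvagin's Tamagawa defect, exactly (pointwise, at Heegner data).** Same data and PUBLISHED
binders as `missingUpperBoundAt_of_shaIndexBound` (`X11b/BDPRouteHalves.lean`) WITHOUT the
hypothesis `p ∤ ∏_ℓ c_ℓ(E)`: from a bound of Kolyvagin's shape `ord_p #Ш(E/K) ≤ 2·ord_p [E(K):ℤP]`
(`hU`), the `≥`-half of the twist's rank-`0` `p`-part (`htw`) and the transports, `#Ш(E)_an` is a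
rational `q` with `ord_p #Ш(E) ≤ ord_p q + 2·ord_p ∏_ℓ c_ℓ(E)`. Arithmetic:
`v(Ш_W) + v(Ш_d) = v(Ш_K) ≤ 2v(I) = v(q) + v(q_d) + v(c_W) + 2v(t_d) ≤ v(q) + v(Ш_d) + v(c_d) + v(c_W)`.
NO typed input. [cite: JetchevSkinnerWan2017, §7.4.2 (p. 31)]
[cite: McCallumLMS1991, §1 Theorem (Kolyvagin), p. 296] [cite: Miller2011LMS, Def. 1.1] -/
theorem padicValNat_shaOrder_le_add_of_shaIndexBound
    (W : WeierstrassCurve ℚ) [W.IsElliptic] [W.IsGloballyMinimal] (p : ℕ) [Fact p.Prime]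
    (N : ℕ) [NeZero N] (K : Type) [Field K] [NumberField K]
    (Dt : ModularParametrizationData W N) (H : HeegnerDatum N (NumberField.discr K)) (ι : K →+* ℂ)
    (P : (W.baseChange K).toAffine.Point)
    -- the published inputs (named facts of the tree)
    (hGZ : gross_zagier N W K) (hKo : kolyvagin N W K)
    (hGZK : rank_eq_analyticRank_of_analyticRank_le_one) (hmod : hasEntireLFunction_rat)
    -- the data
    (hK : IsImaginaryQuadratic K) (hHN : SatisfiesHeegnerHypothesis N K)
    (hP : WeierstrassCurve.Affine.Point.map ι.toRatAlgHom P = heegnerPointComplex Dt H)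
    (hp2 : p ≠ 2) (hc : ¬ (p : ℤ) ∣ Dt.c) (hμ : ¬ p ∣ Units.torsionOrder K)
    (hr : W.analyticRank = 1)
    (hLt : (W.quadraticTwist (NumberField.discr K : ℚ)).entireLFunction 1 ≠ 0)
    -- a globally minimal model of the quadratic twist by `d_K`
    (Wd : WeierstrassCurve ℚ) [Wd.IsElliptic] [Wd.IsGloballyMinimal] (Cd : VariableChange ℚ)
    (hWd : Cd • W.quadraticTwist (NumberField.discr K : ℚ) = Wd)
    (hu : padicValRat p (Cd.u : ℚ) = 0)
    (htam : padicValNat p Wd.tamagawaProduct = padicValNat p W.tamagawaProduct)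
    -- the `≥`-half of the rank-zero `p`-part for the twist
    (htw : ∃ q : ℚ, Wd.entireLFunction 1 / (Wd.realPeriodRat : ℂ) = (q : ℂ) ∧
      padicValRat p q ≤ (padicValNat p Wd.shaOrder : ℤ) + padicValNat p Wd.tamagawaProduct -
        2 * padicValNat p Wd.torsionOrder)
    -- an upper bound of Kolyvagin's shape over `K`
    (hU : Finite (W.baseChange K).sha → ¬ IsOfFinAddOrder P →
      padicValNat p (Nat.card (W.baseChange K).sha) ≤
        2 * padicValNat p (AddSubgroup.zmultiples P).index) :
    ∃ q : ℚ, shaAn W = (q : ℂ) ∧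
      (padicValNat p W.shaOrder : ℤ) ≤ padicValRat p q + 2 * padicValNat p W.tamagawaProduct := by
  obtain ⟨qd, hqd, hvqd⟩ := htw
  obtain ⟨-, hfinK, hsha, q, hq, hval⟩ := exists_shaAn_padicVal_eq_of_heegner W p N K Dt H ι P
    hGZ hKo hGZK hmod hK hHN hP hp2 hc hμ hr hLt Wd Cd hWd hu qd hqd
  -- the Heegner point has infinite order (`L'(E,1) ≠ 0`, `L(E^D,1) ≠ 0`, Gross–Zagier)
  have hL0 : W.entireLFunction 1 = 0 := entireLFunction_one_eq_zero_of_analyticRank_eq_one hr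
  obtain ⟨-, hderiv⟩ := leadingLCoeff_eq_deriv_of_analyticRank_eq_one hr
  have hLK : LDerivEK W K ≠ 0 := by
    rw [lDerivEK_eq_deriv_mul W K hmod hL0]; exact mul_ne_zero hderiv hLt
  have hPinf : ¬ IsOfFinAddOrder P :=
    (lDerivEK_ne_zero_iff_not_isOfFinAddOrder W N K hGZ hK hHN ⟨Dt, H, ι, hP⟩).mp hLK
  have hKU : padicValNat p (W.baseChange K).shaOrder ≤
      2 * padicValNat p (AddSubgroup.zmultiples P).index := hU hfinK hPinf
  refine ⟨q, hq, ?_⟩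
  have e1 : (padicValNat p (W.baseChange K).shaOrder : ℤ) ≤
      2 * padicValNat p (AddSubgroup.zmultiples P).index := by exact_mod_cast hKU
  have e2 : (padicValNat p (W.baseChange K).shaOrder : ℤ) =
      padicValNat p W.shaOrder + padicValNat p Wd.shaOrder := by exact_mod_cast hsha
  have e3 : (padicValNat p Wd.tamagawaProduct : ℤ) = padicValNat p W.tamagawaProduct := by
    exact_mod_cast htam
  omega

/-- **Kolyvagin's Tamagawa defect at fixed Heegner data of a pair of X11b with `p ≥ 5` and a
(ram) prime** (the data-level step of `padicValNat_shaOrder_le_add_of_classX11b_of_ram`, as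
`halves_of_heegnerData` is for the halves): transports (a)–(e) to the minimal twist model
(`TwistTransport*.lean`), Skinner 2016 Thm. C for the twist (`hSk`), and a Kolyvagin-shape bound
over `K` (`hU`) give `#Ш(E)_an = q ∈ ℚ` with `ord_p #Ш(E) ≤ ord_p q + 2·ord_p ∏_ℓ c_ℓ(E)`.
[cite: JetchevSkinnerWan2017, §7.4.2 (p. 31)] [cite: Skinner2016PacificMC, Thm. C (§1)]
[cite: Miller2011LMS, Def. 1.1] -/
theorem padicValNat_shaOrder_le_add_of_heegnerData
    (W : WeierstrassCurve ℚ) [W.IsElliptic] [W.IsGloballyMinimal] (p : ℕ) [Fact p.Prime]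
    [NeZero (W.conductorNorm ℤ)] (K : Type) [Field K] [NumberField K]
    (Dt : ModularParametrizationData W (W.conductorNorm ℤ))
    (H : HeegnerDatum (W.conductorNorm ℤ) (NumberField.discr K)) (ι : K →+* ℂ)
    (P : (W.baseChange K).toAffine.Point)
    -- the published inputs (named facts of the tree)
    (hGZ : gross_zagier (W.conductorNorm ℤ) W K) (hKo : kolyvagin (W.conductorNorm ℤ) W K)
    (hSk : Skinner2016.thmC_padicValRat_bsd_rank_zero)
    (hGZK : rank_eq_analyticRank_of_analyticRank_le_one) (hmod : hasEntireLFunction_rat)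
    -- the pair
    (hr : W.analyticRank = 1) (hp5 : 5 ≤ p) (hmult : Mult W p) (hirr : Irr W p) (hram : Ram W p)
    -- the Heegner data
    (hK : IsImaginaryQuadratic K) (hHN : SatisfiesHeegnerHypothesis (W.conductorNorm ℤ) K)
    (hP : WeierstrassCurve.Affine.Point.map ι.toRatAlgHom P = heegnerPointComplex Dt H)
    (hc : ¬ (p : ℤ) ∣ Dt.c) (hμ : ¬ p ∣ Units.torsionOrder K)
    (hLt : (W.quadraticTwist (NumberField.discr K : ℚ)).entireLFunction 1 ≠ 0)
    (Wd : WeierstrassCurve ℚ) [Wd.IsElliptic] [Wd.IsGloballyMinimal] (Cd : VariableChange ℚ)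
    (hWd : Cd • W.quadraticTwist (NumberField.discr K : ℚ) = Wd)
    -- an upper bound of Kolyvagin's shape over `K`
    (hU : Finite (W.baseChange K).sha → ¬ IsOfFinAddOrder P →
      padicValNat p (Nat.card (W.baseChange K).sha) ≤
        2 * padicValNat p (AddSubgroup.zmultiples P).index) :
    ∃ q : ℚ, shaAn W = (q : ℂ) ∧
      (padicValNat p W.shaOrder : ℤ) ≤ padicValRat p q + 2 * padicValNat p W.tamagawaProduct := by
  have hp2 : p ≠ 2 := by omega
  have hp3 : 3 ≤ p := by omega
  have hD0 : (NumberField.discr K : ℚ) ≠ 0 := by exact_mod_cast NumberField.discr_ne_zero K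
  haveI hEt : (W.quadraticTwist (NumberField.discr K : ℚ)).IsElliptic :=
    W.isElliptic_quadraticTwist hD0
  -- transports (a)–(e) to the minimal twist model
  have hmultd : Wd.HasMultiplicativeReductionAtPrime p :=
    hasMultiplicativeReductionAtPrime_twist_of_heegner' W p K hK hHN hmult Cd hWd
  have hirrd : Wd.HasIrreducibleModPGaloisRep p :=
    hasIrreducibleModPGaloisRep_twist_model W p K hK.1 hirr Cd hWd
  have hramd : Ram Wd p := ram_twist_of_heegner W p K hK hHN hram Cd hWd
  have htam : padicValNat p Wd.tamagawaProduct = padicValNat p W.tamagawaProduct :=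
    padicValNat_tamagawaProduct_twist_of_heegner W p hp5 K hK hHN Cd hWd
  have hu : padicValRat p (Cd.u : ℚ) = 0 :=
    padicValRat_u_eq_zero_of_twist_minimal W p K hK hHN hmult Cd hWd
  -- the twist: `L(E^D,1) ≠ 0`, finiteness, and Skinner's Thm. C
  have hLt' : (W.quadraticTwist (NumberField.discr K : ℚ)).entireLFunction = Wd.entireLFunction := by
    rw [← hWd, entireLFunction_smul]
  have hLd1 : Wd.entireLFunction 1 ≠ 0 := by rw [← hLt']; exact hLt
  have hrd : Wd.analyticRank = 0 := (Wd.analyticRank_eq_zero_iff_holds (hmod Wd)).2 hLd1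
  have hfinSd : Finite Wd.sha := (hGZK Wd (by omega)).2
  obtain ⟨qd, hqd, hvqd⟩ := hSk Wd p hp3 (Or.inr hmultd) hirrd hramd hLd1 hfinSd
  exact padicValNat_shaOrder_le_add_of_shaIndexBound W p (W.conductorNorm ℤ) K Dt H ι P hGZ hKo hGZK
    hmod hK hHN hP hp2 hc hμ hr hLt Wd Cd hWd hu htam ⟨qd, hqd, hvqd.le⟩ hU

/-- **Kolyvagin's Tamagawa defect, exactly, on X11b ∧ `p ≥ 5` ∧ (ram) — UNCONDITIONAL (published
named facts only).** For every `(E,p)` in X11b (`r_an = 1`, `p` odd, multiplicative at `p`, `E[p]`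
irreducible) with `p ≥ 5` and a (ram) prime — NO condition on the Tamagawa numbers —: `#Ш(E)_an` is a
rational `q` with `ord_p #Ш(E) ≤ ord_p q + 2·ord_p ∏_ℓ c_ℓ(E)`. Inputs: the same TEN published
named facts as `missingUpperBoundAt_of_classX11b_of_locus` (Gross–Zagier, Kolyvagin ×2, Skinner
2016 Thm. C, Gross–Zagier–Kolyvagin over `ℚ`, modularity ×2, Friedberg–Hoffstein, Mazur 1978
Cor. 4.1, Néron mapping property), assembled exactly as there (`halves_of_heegnerData`'s data:
Friedberg–Hoffstein field with `|d_K| > 4`, Manin-unit datum `exists_maninDatum`, minimal twist model,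
transports (a)–(e), Kolyvagin with `ρ̄_{E,p}` surjective by `surj_of_irr_of_ram`). On `Locus`
(`p ∤ ∏c_ℓ`) this is the unconditional upper half; on the atom "(ram, `p ∣ ∏c_ℓ`)" it is what the
published record gives at `p ∥ N` with the classical parametrisation (Jetchev 2008 Cor. 1.5 needs
`p ∤ N`; Jetchev–Skinner–Wan 2017 §7.4.2 the Shimura curve `X_{N⁺,N⁻}`). Nothing booked; X11b's
label unchanged. [cite: JetchevSkinnerWan2017, §7.4.2 (p. 31) and Thm. 4.4.1]
[cite: Jetchev2008, Cor. 1.5 (p. 3)] [cite: McCallumLMS1991, §1 Theorem (Kolyvagin), p. 296]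
[cite: Skinner2016PacificMC, Thm. C (§1)] [cite: Miller2011LMS, Def. 1.1] -/
theorem padicValNat_shaOrder_le_add_of_classX11b_of_ram
    -- published inputs (named facts of the tree)
    (hGZ : ∀ (N : ℕ) [NeZero N] (W : WeierstrassCurve ℚ) (K : Type) [Field K] [NumberField K],
      gross_zagier N W K)
    (hKo : ∀ (N : ℕ) [NeZero N] (W : WeierstrassCurve ℚ) (K : Type) [Field K] [NumberField K],
      kolyvagin N W K)
    (hB : ∀ (N : ℕ) [NeZero N] (W : WeierstrassCurve ℚ) (K : Type) [Field K] [NumberField K],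
      Kolyvagin1990_padicValNat_card_sha_le N W K)
    (hSk : Skinner2016.thmC_padicValRat_bsd_rank_zero)
    (hGZK : rank_eq_analyticRank_of_analyticRank_le_one) (hmod : hasEntireLFunction_rat)
    (hnf : exists_isNewformOf)
    (hFH : friedbergHoffstein_exists_heegnerField_split_twist_ne_zero)
    (hMaz : mazur_not_dvd_maninConstant_of_odd) (hNS : integral_neronScaling_of_isGloballyMinimal) :
    ∀ (W : WeierstrassCurve ℚ) [W.IsElliptic] [W.IsGloballyMinimal] (p : ℕ) [Fact p.Prime],
      ClassX11b W p → 5 ≤ p → Ram W p →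
        ∃ q : ℚ, shaAn W = (q : ℂ) ∧
          (padicValNat p W.shaOrder : ℤ) ≤ padicValRat p q + 2 * padicValNat p W.tamagawaProduct := by
  intro W _ _ p _ hX hp5 hram
  have hp : p.Prime := Fact.out
  obtain ⟨hr, -, hmult, hirr⟩ := hX
  have hp2 : p ≠ 2 := by omega
  haveI : NeZero (W.conductorNorm ℤ) := ⟨(W.conductorNorm_pos_holds).ne'⟩
  -- the sign of the functional equation is `−1` (modularity, `r_an = 1`)
  have hw : W.rootNumber = -1 := by
    rw [WeierstrassCurve.rootNumber_eq_neg_one_pow_analyticRank_of_exists_isNewformOf hnf W, hr]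
    norm_num
  -- the auxiliary field (Friedberg–Hoffstein): every `ℓ ∣ N` split, `|d_K| > 4`, `L(E^{d_K},1) ≠ 0`
  obtain ⟨K, _, _, hK, hdisc, hHN, -, hLt⟩ := hFH W hw p hp 4
  -- `w_K = 2`, prime to `p ≥ 5`
  have hμ : ¬ p ∣ Units.torsionOrder K := by
    haveI : IsTotallyComplex K := hK.2
    have hneg : NumberField.discr K < 0 := discr_neg_of_finrank_eq_two K hK.1
    have habs : ((NumberField.discr K).natAbs : ℤ) = -NumberField.discr K :=
      Int.ofNat_natAbs_of_nonpos hneg.le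
    have h4 : NumberField.discr K < -4 := by
      have : (4 : ℤ) < ((NumberField.discr K).natAbs : ℤ) := by exact_mod_cast hdisc
      omega
    rw [Literature.NumberTheory.DiophantineGeometry.torsionOrder_eq_two_of_discr_lt hK.1 h4]
    intro h2
    have := Nat.le_of_dvd two_pos h2
    omega
  -- the Heegner datum with `p ∤ c` (modularity, Mazur 1978 Cor. 4.1, Néron mapping property)
  obtain ⟨Dt, H, ι, P, hP, hc⟩ :=
    exists_maninDatum hnf hMaz hNS W p (W.conductorNorm ℤ) K rfl hp5 hmult hirr hK hHN
  -- a globally minimal model of the twist (Néron; Silverman VIII.8 Cor. 8.3)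
  have hD0 : (NumberField.discr K : ℚ) ≠ 0 := by exact_mod_cast NumberField.discr_ne_zero K
  haveI hEt : (W.quadraticTwist (NumberField.discr K : ℚ)).IsElliptic :=
    W.isElliptic_quadraticTwist hD0
  obtain ⟨Cd, hCd⟩ := hasGlobalMinimalModel_rat_holds (W.quadraticTwist (NumberField.discr K : ℚ))
  haveI : (Cd • W.quadraticTwist (NumberField.discr K : ℚ)).IsGloballyMinimal := hCd
  have hWd : Cd • W.quadraticTwist (NumberField.discr K : ℚ) =
      Cd • W.quadraticTwist (NumberField.discr K : ℚ) := rfl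
  -- Kolyvagin's bound (`ρ̄_{E,p}` surjective from irr + ram)
  have hsurj : Surj W p := surj_of_irr_of_ram W p hirr hram
  exact padicValNat_shaOrder_le_add_of_heegnerData W p K Dt H ι P (hGZ _ W K) (hKo _ W K) hSk hGZK
    hmod hr hp5 hmult hirr hram hK hHN hP hc hμ hLt (Cd • W.quadraticTwist (NumberField.discr K : ℚ))
    Cd hWd (fun _ hnt ↦ hB _ W K hK hHN ⟨Dt, H, ι, hP⟩ hnt hp hp2 hsurj)

end Summit.BirchSwinnertonDyer.Rank1Residual.X11b

end
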